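/-
Origin: expansion seat `planner-pub-hodgecm-pv02-g3-0`, handover #2 2026-08-18T05:10:11Z (`HOME/pub-hodgecm-pv02-g3/lean/Pv02g3/PerL34/CharSpansCR.lean`, md5 73d2a010, 232 lines);
landed by the gen-6 packager in gate run 22 as `HodgeCM/PerL34/CharSpansCR.lean` (import ^import Pv[0-9]+copy\.(?:PerL34\.)?→import HodgeCM.PerL34. ×1; import ^import Pv[0-9]+g[0-9]+\.PerL34\.→import HodgeCM.PerL34. ×1; stripped 4 #print/#check/#eval lines).
-/
/-
Origin: planner-pub-hodgecm-pv02-g3-0 (unit pub-hodgecm-pv02-g3, DAG-NODE PROVER #02 gen 3), 2026-08-18.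
Proposed tree path: `HodgeCM/PerL34/CharSpansCR.lean` (new, additive; lands AFTER `CharSpansWeil` (pv03),
`CharSpans` (pv02-g2), `P43_weilModel` (pv14) and `BallCR` (pv02-g3)).
PACKAGER: the WIP imports below become `import HodgeCM.PerL34.CharSpansWeil` and `import HodgeCM.PerL34.BallCR`
(`Pv03copy.PerL34.CharSpansWeil` is my verbatim vendored copy of pv03's 56c53e54 with only its three import lines
re-prefixed; `Pv02g3.PerL34.BallCR` is my own cffde95e).  KERNEL: nothing cited, nothing asserted.
-/
import Summits.HodgeConjecture.HodgeCM.PerL34.CharSpansWeil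
import Summits.HodgeConjecture.HodgeCM.PerL34.BallCR_2

/-!
# Seam S1 with (X2) CONSUMED: the Weil package over the canonical ball dictionary `BallCR.ballFD`

pv03's `CharSpansWeil.WeilPackage M` (= the binders of pv14's `groupInputs_of_weilModel`) carries three data that
the kernel theorem `BallCR.holomorphicOfPminus_ball` ((X2) for the canonical ball dictionary) makes superfluous:

* the forms dictionary `FD` and the identification `hHol : FD.Hol = (D M).Hol` — FIXED to `BallCR.ballFD`, whose
  `Hol` is `BallCR.Hol` (frame readings of one-forms on `𝔹²` that are `ℂ`-differentiable at every point), once the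
  free field `Hol` of pv02-g2's `CharLineSpans` is SET to `BallCR.Hol` (`CharLineSpansCR.toCharLineSpans`);
* the (X2) binder `hX2 : HolomorphicOfPminus FD` — now the THEOREM `BallCR.holomorphicOfPminus_ball`;

and pv03's `WeilStepsInput T` carries the conjunct `HolFrame …` ("every element of `Hol` is a continuous frame
function", feeding the definitional sentence `HolFromBall`) — now the THEOREM `BallCR.holFrame_of_hol_eq`.

This file records the smaller input: `CharLineSpansCR` (pv02-g2's data minus `Hol`), `WeilPackageCR` (pv03's
package minus `FD`, `hHol`, `hX2`, with (X1) stated against the CONCRETE `ballFD`), `WeilStepsInputCR T` (pv03's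
residual minus `HolFrame`), and the implications `WeilPackageCR.toWeilPackage`,
`weilStepsInput_of_CR : WeilStepsInputCR T → WeilStepsInput T`, `charSpanStepsInput_of_CR`,
`open_thetaWedge_of_CR`; and the remark `thetaPKilled_ballFD_iff`: (X1) against `ballFD` ⟺ N33b (i) ("`u_F` is a
holomorphic one-form") with the CONCRETE `Hol`.

What (X1) says for `ballFD` (pv14 `P43Forms.ThetaPKilledByPminus ballFD (Mk i χ)`): for every `F ∈ Θ_i(χ)[𝔭₊]`,
`u_F ∈ BallCR.Cochain` (the theta one-form is the frame reading of a real-differentiable form on `𝔹²`) and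
`X u_F = 0` for every `X ∈ range BallCR.Xminus` (the `𝔭₋`-operators `X⁻_v = X_v + i X_{iv}` along pv03's boosts);
by `BallCR.killed_iff_hol` this conjunction is equivalent to "`u_F` is (the frame reading of) a holomorphic
one-form".  It remains INPUT(N31) + PRINT ([BW] VI 4.11; pv14 `P43X1Bridge`), exactly as before — only now against a
dictionary whose (X2) half is a theorem rather than a binder.

Labels: everything here is KERNEL packaging (no statement of any other seat is modified; pv03's and pv14's
theorems are applied by name).
-/

noncomputable section

open Complex

namespace HodgeCM
namespace PerL34
namespace CharSpansCR

open HodgeCM.PerL34.BallModel HodgeCM.PerL34.BallSpans HodgeCM.PerL34.BallFrame HodgeCM.PerL34.CharSpans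
  HodgeCM.PerL34.CharSpansWeil HodgeCM.PerL34.WedgeNonvanishing HodgeCM.PerL34.WedgeToClasses
  HodgeCM.PerL34.P43WeilModel

variable {U : Universe} (T : U.ThetaModel)

/-- **(X1) against the canonical ball dictionary IS N33b (i) with a concrete `Hol`**: for a theta-kernel model
`Mk` over `U(2,1)` with fibre `ℂ²`, `ThetaPKilledByPminus BallCR.ballFD Mk` ("every `u_F` is a real-differentiable
frame function killed by the `𝔭₋`-operators") holds iff every `u_F`, `F ∈ Θ[𝔭₊]`, lies in `BallCR.Hol` (is the
frame reading of a one-form `ℂ`-differentiable at every point of `𝔹²`) — `BallCR.killed_iff_hol` +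
`BallCR.Hol_le_Cochain`.  So pv14's (X1)+(X2) split of N33b (i) costs nothing on the ball route. -/
theorem thetaPKilled_ballFD_iff {Gc Gf S : Type*} [Group Gc] [Group Gf] [AddCommGroup S] [Module ℂ S]
    (Mk : P43Forms.ThetaKernelData U21 Gc Gf (Fin 2 → ℂ) S) :
    P43Forms.ThetaPKilledByPminus BallCR.ballFD Mk ↔ ∀ F ∈ Mk.ThetaP, P43Forms.uEval F ∈ BallCR.ballFD.Hol := by
  refine ⟨fun h F hF => (BallCR.killed_iff_hol (h F hF).1).mp (h F hF).2, fun h F hF => ?_⟩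
  have hC : P43Forms.uEval F ∈ BallCR.ballFD.Cochain := BallCR.Hol_le_Cochain (h F hF)
  exact ⟨hC, (BallCR.killed_iff_hol hC).mpr (h F hF)⟩

/-- **pv02-g2's `CharLineSpans T V c` WITHOUT the free field `Hol`**: the compact factors, `G_U(𝔸_f)`, the image
`Γ` of `G_U(L₀)`, the slices `Θ_i(χ)[𝔭₊]`, and the level / class maps of the forms dictionary.  `Hol` is no longer
a datum: it is `BallCR.Hol` (`toCharLineSpans`). -/
structure CharLineSpansCR {L : CMField} {ι₁ : L →+* ℂ} (V : HermSpace3 L ι₁) (c : SeesawCtx L) where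
  /-- the compact factors `∏_{b ≠ ι₁} U(3)` -/
  Gc : Type
  /-- `G_U(𝔸_f)` -/
  Gf : Type
  [iGc : Group Gc]
  [iGf : Group Gf]
  /-- the image of `G_U(L₀)` in `U(2,1) × G_c × G_f` -/
  Γ : Subgroup (U21 × Gc × Gf)
  /-- `Θ_i(χ'_{i+1})[𝔭₊]` for the `i`-th component of the pair `χ ∈ X([T])`, as `ℂ²`-valued functions -/
  ThetaP : (i : Fin 2) → (T.t12 V c).X → Submodule ℂ (U21 × Gc × Gf → (Fin 2 → ℂ))
  /-- a torsion-free level of the form -/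
  lvl : (Ball → (Fin 2 → ℂ)) → Level V
  /-- the de Rham class on `P_Γ` of a form descending to `Γ` -/
  cls : (Γ : Level V) → (Ball → (Fin 2 → ℂ)) → U.CohC (U.pms L ι₁ V Γ) 1

attribute [instance] CharLineSpansCR.iGc CharLineSpansCR.iGf

namespace CharLineSpansCR

variable {T}
variable {L : CMField} {ι₁ : L →+* ℂ} {V : HermSpace3 L ι₁} {c : SeesawCtx L} (M : CharLineSpansCR T V c)

/-- The `CharLineSpans` with **`Hol := BallCR.Hol`** (frame readings `R u` of the one-forms `u : 𝔹² → ℂ²` that are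
`ℂ`-differentiable at every point of the ball). -/
def toCharLineSpans : CharLineSpans T V c where
  Gc := M.Gc
  Gf := M.Gf
  Γ := M.Γ
  ThetaP := M.ThetaP
  Hol := BallCR.Hol
  lvl := M.lvl
  cls := M.cls

/-- The `Hol` of the constructed data IS `BallCR.ballFD.Hol`. -/
theorem hol_eq : (CharSpansWeil.D M.toCharLineSpans).Hol = BallCR.ballFD.Hol := rfl

/-- (Ported verbatim from the HodgeCMPerL package; no docstring in the source.) -/
theorem lineSpans_hol_eq : M.toCharLineSpans.toBallSpanModel.toLineSpans.Hol = BallCR.ballFD.Hol := rfl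

/-- **`HolFrame` is a THEOREM** for the constructed data (`BallCR.holFrame_of_hol_eq`). -/
theorem holFrame : HolFrame M.toCharLineSpans.toBallSpanModel.toLineSpans :=
  BallCR.holFrame_of_hol_eq _ M.lineSpans_hol_eq

/-- **`HolFromBall` (D2/D6) is a THEOREM** for the constructed data. -/
theorem holFromBall : M.toCharLineSpans.toBallSpanModel.toLineSpans.HolFromBall :=
  BallCR.holFromBall_of_hol_eq _ M.lineSpans_hol_eq

end CharLineSpansCR

/-- **pv03's `WeilPackage` WITHOUT `FD`, `hHol`, `hX2`**: the Fock–Schwartz model spaces and theta-kernel models with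
the slices of `M`, the `K`-type `𝔭₊`, the Weil typing, N10 in invariant form, (X1) **for the canonical ball
dictionary `BallCR.ballFD`**, and `SomeNonzero`. -/
structure WeilPackageCR {L : CMField} {ι₁ : L →+* ℂ} {V : HermSpace3 L ι₁} {c : SeesawCtx L}
    (M : CharLineSpansCR T V c) where
  /-- the Fock–Schwartz model spaces, per fixed line `i` and character `χ` -/
  S : (i : Fin 2) → (T.t12 V c).X → Type
  [iS₁ : ∀ i χ, AddCommGroup (S i χ)]
  [iS₂ : ∀ i χ, Module ℂ (S i χ)]
  /-- the theta-kernel models with the slices of `M` -/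
  Mk : (i : Fin 2) → (χ : (T.t12 V c).X) → P43Forms.ThetaKernelData U21 M.Gc M.Gf (Fin 2 → ℂ) (S i χ)
  hM : ∀ i χ, (Mk i χ).ThetaP = M.ThetaP i χ
  /-- the compact group `K_c` and the `K`-type `𝔭₊` -/
  Kc : Type
  P : Type
  [iP₁ : AddCommGroup P]
  [iP₂ : Module ℂ P]
  ρP : Kc → P →ₗ[ℂ] P
  ωinf : (i : Fin 2) → (χ : (T.t12 V c).X) → U21 → S i χ →ₗ[ℂ] S i χ
  ρ : (i : Fin 2) → (χ : (T.t12 V c).X) → Kc → S i χ →ₗ[ℂ] S i χ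
  /-- the Weil typing per `(i, χ)` (pv14) -/
  W : ∀ i χ, WeilTyping (Mk i χ) (ωinf i χ) (ρ i χ) ρP
  /-- N10 in invariant form -/
  hΘ : ∀ i χ, ∀ γ ∈ M.Γ,
    (W i χ).Θ ∘ₗ (ωinf i χ γ.1 ∘ₗ (Mk i χ).ωc γ.2.1 ∘ₗ (Mk i χ).ωf γ.2.2) = (W i χ).Θ
  /-- **(X1) for the canonical ball dictionary**: every `u_F`, `F ∈ Θ_i(χ)[𝔭₊]`, is the frame reading of a
  real-differentiable form on `𝔹²` and is killed by the `𝔭₋`-operators `X⁻_v` (⟺ `∂̄ u_F = 0`,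
  `BallCR.killed_iff_hol`).  INPUT(N31) + PRINT [BW] VI 4.11. -/
  hX1 : ∀ i χ, P43Forms.ThetaPKilledByPminus BallCR.ballFD (Mk i χ)
  /-- N30 + N33a -/
  hne : (CharSpansWeil.D M.toCharLineSpans).SomeNonzero

attribute [instance] WeilPackageCR.iS₁ WeilPackageCR.iS₂ WeilPackageCR.iP₁ WeilPackageCR.iP₂

namespace WeilPackageCR

variable {T}
variable {L : CMField} {ι₁ : L →+* ℂ} {V : HermSpace3 L ι₁} {c : SeesawCtx L} {M : CharLineSpansCR T V c}

/-- **pv03's `WeilPackage` from the smaller package**: `FD := BallCR.ballFD`, `hHol := rfl`,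
`hX2 := BallCR.holomorphicOfPminus_ball` (KERNEL). -/
def toWeilPackage (P : WeilPackageCR T M) : WeilPackage M.toCharLineSpans where
  FD := BallCR.ballFD
  hHol := rfl
  S := P.S
  Mk := P.Mk
  hM := P.hM
  Kc := P.Kc
  P := P.P
  ρP := P.ρP
  ωinf := P.ωinf
  ρ := P.ρ
  W := P.W
  hΘ := P.hΘ
  hX1 := P.hX1
  hX2 := BallCR.holomorphicOfPminus_ball
  hne := P.hne

/-- `GroupInputs` (pv02's five INPUT Props) for the constructed data, from the smaller package. -/
theorem groupInputs (P : WeilPackageCR T M) : M.toCharLineSpans.toBallSpanModel.GroupInputs :=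
  groupInputs_of_weil M.toCharLineSpans P.toWeilPackage

/-- `CharLineSpans.Inputs` for the constructed data: the smaller package + `Dense Δ` (PRINT) + the three dictionary
Props; `HolFromBall` is supplied by the kernel. -/
theorem inputs (P : WeilPackageCR T M)
    (hΔ : Dense (M.toCharLineSpans.toBallSpanModel.toBallFormsModel.Δ : Set U21))
    (h₀ : M.toCharLineSpans.toBallSpanModel.toBallFormsModel.toFormsModelT.Dict_thetaClass₀ T c)
    (h₁ : M.toCharLineSpans.toBallSpanModel.toBallFormsModel.toFormsModelT.Dict_thetaClass₁ T c)
    (hcup : M.toCharLineSpans.toBallSpanModel.toBallFormsModel.toFormsModelT.toFormsModel.Dict_cupWedge) :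
    M.toCharLineSpans.Inputs :=
  inputs_of_weil M.toCharLineSpans P.toWeilPackage M.holFrame hΔ h₀ h₁ hcup

end WeilPackageCR

/-- **The per-context residual of node N33 with S1 wired AND (X2)/`HolFrame` consumed**: per good context, the data
`M` (no `Hol`), a `WeilPackageCR` (no `FD`/`hHol`/`hX2`), `Dense Δ` (PRINT: real approximation), and the three
dictionary Props. -/
def WeilStepsInputCR : Prop :=
  ∀ {L : CMField} {ι₁ : L →+* ℂ} (V : HermSpace3 L ι₁) (c : SeesawCtx L), T.GoodCtx ι₁ c →
    ∃ M : CharLineSpansCR T V c, Nonempty (WeilPackageCR T M) ∧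
      Dense (M.toCharLineSpans.toBallSpanModel.toBallFormsModel.Δ : Set U21) ∧
      M.toCharLineSpans.toBallSpanModel.toBallFormsModel.toFormsModelT.Dict_thetaClass₀ T c ∧
      M.toCharLineSpans.toBallSpanModel.toBallFormsModel.toFormsModelT.Dict_thetaClass₁ T c ∧
      M.toCharLineSpans.toBallSpanModel.toBallFormsModel.toFormsModelT.toFormsModel.Dict_cupWedge

/-- pv03's `WeilStepsInput T` from the smaller input (the `HolFrame` conjunct is `CharLineSpansCR.holFrame`). -/
theorem weilStepsInput_of_CR (h : WeilStepsInputCR T) : WeilStepsInput T := by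
  intro L ι₁ V c hc
  obtain ⟨M, ⟨P⟩, hΔ, h₀, h₁, hcup⟩ := h V c hc
  exact ⟨M.toCharLineSpans, ⟨P.toWeilPackage⟩, M.holFrame, hΔ, h₀, h₁, hcup⟩

/-- pv02-g2's `CharSpanStepsInput T` from the smaller input. -/
theorem charSpanStepsInput_of_CR (h : WeilStepsInputCR T) : CharSpanStepsInput T :=
  charSpanStepsInput_of_weil T (weilStepsInput_of_CR T h)

/-- **A6 `Open_thetaWedge` (node N33) with S1, S2 wired and (X2)/`HolFrame` consumed**: `N33eClosed` (pv01,
KERNEL), pv13's cluster outputs (N31, allowedness), and `WeilStepsInputCR T`. -/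
theorem open_thetaWedge_of_CR (hE : N33eClosed) (h31 : ClusterOutputs T) (h : WeilStepsInputCR T) :
    T.Open_thetaWedge :=
  open_thetaWedge_of_weil T hE h31 (weilStepsInput_of_CR T h)

end CharSpansCR
end PerL34
end HodgeCM

end

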